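import Summits.ValiantsHypothesis.ValiantsHypothesis.Theorems.BarrierLeverAnchoredDoorHitsLowerPairsStarDoor
import Summits.ValiantsHypothesis.ValiantsHypothesis.Theorems.BarrierLeverAnchoredDoorHitsLowerPairsDistinctAnchorsSpec
import Summits.ValiantsHypothesis.ValiantsHypothesis.Theorems.BarrierLeverAnchoredDoorHitsLowerPairsSplitCalculus

/-!
# Route BarrierLever — support item `AnchoredDoorHitsLowerPairs` (stmt-ValiantsHypothesis-22510), line `anchored_peeling`:
# SQUARE-FREE CALCULUS FOR THE PRODUCT DOOR — the layout of `Π = ∏_d (1 + y_d ε_d) · ∏_a (1 + x_a η_a)` is the star-forest matrix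

Towards the kernel arrow `Stmt.conjStarLower → item` (node file `…StarDoor`, p725521). This file is the algebra half: the congruence
"equal square-free coefficients" (`SqEq`, a ring congruence since it is equality modulo the monomial ideal `(x_a², y_d²)`), the telescoping
and linearisation identities `∏_b (1 + t c_b) ≡ 1 + t Σ_b c_b` for `t² ≡ 0`, the normal forms of `∏_d (1 + y_d ∏_b (1 + g_{bd} x_b))` and
`∏_a (1 + x_a ∏_e (1 + d_{ae} y_e))` as sums of square-free monomials with coefficients `∏_{b∈A} Σ_{d∈S} g_{bd}` resp. `∏_{e∈S} Σ_{a∈A} d_{ae}`,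
and the conclusion `coeff_{x^U y^W} Π = starEntry g d U W` (`coeff_pexpo_piPoly`). The 𝔄₂ membership of the product door and the matrix
identity with the item's layout follow in the companion file. Nothing here bears on crux 14610 or `VP ≠ VNP`.
-/

set_option linter.dupNamespace false

namespace Summit.ValiantsHypothesis.ValiantsHypothesis.Theorems.BarrierLever.AnchoredPeeling

open Finset MvPolynomial
open Summit.ValiantsHypothesis.ValiantsHypothesis.Theorems.BarrierLever.BrickCalculus (pexpo pexpo_def pexpo_le_iff pexpo_sub
  pexpo_apply_castAdd pexpo_apply_natAdd)

noncomputable section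

namespace StarDoor

variable {h : ℕ}

/-! ## 1. Square-free congruence -/

/-- `SqEq F G`: `F` and `G` have the same coefficient at every square-free monomial (exponents `≤ 1`). -/
def SqEq (F G : MvPolynomial (Fin (h + h)) ℂ) : Prop :=
  ∀ m : Fin (h + h) →₀ ℕ, (∀ i, m i ≤ 1) → coeff m F = coeff m G

/-- `SqEq` is reflexive. -/
theorem SqEq.refl (F : MvPolynomial (Fin (h + h)) ℂ) : SqEq F F := fun _ _ => rfl

/-- `SqEq` is symmetric. -/
theorem SqEq.symm {F G : MvPolynomial (Fin (h + h)) ℂ} (hFG : SqEq F G) : SqEq G F := fun m hm => (hFG m hm).symm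

/-- `SqEq` is transitive. -/
theorem SqEq.trans {F G H : MvPolynomial (Fin (h + h)) ℂ} (hFG : SqEq F G) (hGH : SqEq G H) : SqEq F H :=
  fun m hm => (hFG m hm).trans (hGH m hm)

/-- `SqEq` is additive. -/
theorem SqEq.add {F G F' G' : MvPolynomial (Fin (h + h)) ℂ} (h1 : SqEq F G) (h2 : SqEq F' G') : SqEq (F + F') (G + G') := by
  intro m hm
  rw [coeff_add, coeff_add, h1 m hm, h2 m hm]

/-- `SqEq` is multiplicative: divisors of a square-free monomial are square-free. -/
theorem SqEq.mul {F G F' G' : MvPolynomial (Fin (h + h)) ℂ} (h1 : SqEq F G) (h2 : SqEq F' G') : SqEq (F * F') (G * G') := by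
  classical
  intro m hm
  rw [coeff_mul, coeff_mul]
  refine Finset.sum_congr rfl fun x hx => ?_
  have hx' : x.1 + x.2 = m := Finset.HasAntidiagonal.mem_antidiagonal.mp hx
  have h1' : ∀ i, x.1 i ≤ 1 := fun i => by
    have := congr_arg (fun f => f i) hx'
    simp only [Finsupp.coe_add, Pi.add_apply] at this
    have := hm i; omega
  have h2' : ∀ i, x.2 i ≤ 1 := fun i => by
    have := congr_arg (fun f => f i) hx'
    simp only [Finsupp.coe_add, Pi.add_apply] at this
    have := hm i; omega
  rw [h1 x.1 h1', h2 x.2 h2']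

/-- `SqEq` under left multiplication. -/
theorem SqEq.mul_left {F G : MvPolynomial (Fin (h + h)) ℂ} (H : MvPolynomial (Fin (h + h)) ℂ) (h1 : SqEq F G) :
    SqEq (H * F) (H * G) := (SqEq.refl H).mul h1

/-- `SqEq` under right multiplication. -/
theorem SqEq.mul_right {F G : MvPolynomial (Fin (h + h)) ℂ} (H : MvPolynomial (Fin (h + h)) ℂ) (h1 : SqEq F G) :
    SqEq (F * H) (G * H) := h1.mul (SqEq.refl H)

/-- `SqEq` for finite products. -/
theorem SqEq.prod {ι : Type*} (s : Finset ι) {F G : ι → MvPolynomial (Fin (h + h)) ℂ} (hFG : ∀ i ∈ s, SqEq (F i) (G i)) :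
    SqEq (∏ i ∈ s, F i) (∏ i ∈ s, G i) := by
  classical
  induction s using Finset.induction_on with
  | empty => simp [SqEq.refl]
  | insert i s hi ih =>
    rw [Finset.prod_insert hi, Finset.prod_insert hi]
    exact (hFG i (Finset.mem_insert_self i s)).mul (ih fun j hj => hFG j (Finset.mem_insert_of_mem hj))

/-- `SqEq` for finite sums. -/
theorem SqEq.sum {ι : Type*} (s : Finset ι) {F G : ι → MvPolynomial (Fin (h + h)) ℂ} (hFG : ∀ i ∈ s, SqEq (F i) (G i)) :
    SqEq (∑ i ∈ s, F i) (∑ i ∈ s, G i) := by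
  intro m hm
  rw [coeff_sum, coeff_sum]
  exact Finset.sum_congr rfl fun i hi => hFG i hi m hm

/-- A multiple of the square of a variable has no square-free coefficients. -/
theorem SqEq.sq_mul_zero (i : Fin (h + h)) (H : MvPolynomial (Fin (h + h)) ℂ) : SqEq (X i * X i * H) 0 := by
  classical
  intro m hm
  rw [coeff_zero, mul_assoc, coeff_X_mul']
  split_ifs with hi
  · rw [coeff_X_mul']
    have : i ∉ (m - Finsupp.single i 1).support := by
      rw [Finsupp.mem_support_iff, not_not, Finsupp.tsub_apply, Finsupp.single_eq_same]
      have := hm i; omega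
    rw [if_neg this]
  · rfl

/-- `t = X i * u` squares to zero modulo squares: `t * t * H ≡ 0`. -/
theorem SqEq.nil_of_X_mul (i : Fin (h + h)) (u H : MvPolynomial (Fin (h + h)) ℂ) : SqEq (X i * u * (X i * u) * H) 0 := by
  have : X i * u * (X i * u) * H = X i * X i * (u * u * H) := by ring
  rw [this]; exact SqEq.sq_mul_zero i _

/-! ## 2. Linearisation and telescoping -/

/-- **Linearisation:** if `t² ≡ 0` then `∏_{b ∈ s} (1 + t c_b) ≡ 1 + t Σ_{b ∈ s} c_b`. -/
theorem prod_one_add_nil {ι : Type*} (s : Finset ι) (t : MvPolynomial (Fin (h + h)) ℂ) (c : ι → MvPolynomial (Fin (h + h)) ℂ)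
    (ht : ∀ H, SqEq (t * t * H) 0) : SqEq (∏ b ∈ s, (1 + t * c b)) (1 + t * ∑ b ∈ s, c b) := by
  classical
  induction s using Finset.induction_on with
  | empty => simp [SqEq.refl]
  | insert b s hb ih =>
    rw [Finset.prod_insert hb, Finset.sum_insert hb]
    have h1 : SqEq ((1 + t * c b) * ∏ x ∈ s, (1 + t * c x)) ((1 + t * c b) * (1 + t * ∑ x ∈ s, c x)) := ih.mul_left _
    refine h1.trans ?_
    have hexp : (1 + t * c b) * (1 + t * ∑ x ∈ s, c x) = (1 + t * (c b + ∑ x ∈ s, c x)) + t * t * (c b * ∑ x ∈ s, c x) := by ring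
    rw [hexp]
    have h2 := (SqEq.refl (1 + t * (c b + ∑ x ∈ s, c x))).add (ht (c b * ∑ x ∈ s, c x))
    rw [add_zero] at h2
    exact h2

/-- **The double-star splitting of a root factor.** With `t² ≡ 0`: `1 + t ∏_{b∈s}(1 + c_b) ≡ (1 + t) ∏_{b∈s} (1 + t c_b ∏_{b'∈s, b'<b} (1 + c_{b'}))`
(the right-hand factors are the profile-2 anchors carrying ordered tails; telescoping `∏(1+c) = 1 + Σ_b c_b ∏_{b'<b}(1+c_{b'})`). -/
theorem root_factor_split (s : Finset (Fin h)) (t : MvPolynomial (Fin (h + h)) ℂ) (c : Fin h → MvPolynomial (Fin (h + h)) ℂ)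
    (ht : ∀ H, SqEq (t * t * H) 0) :
    SqEq (1 + t * ∏ b ∈ s, (1 + c b)) ((1 + t) * ∏ b ∈ s, (1 + t * (c b * ∏ b' ∈ s with b' < b, (1 + c b')))) := by
  have hlin := prod_one_add_nil s t (fun b => c b * ∏ b' ∈ s with b' < b, (1 + c b')) ht
  have htel : ∏ b ∈ s, (1 + c b) = 1 + ∑ b ∈ s, c b * ∏ b' ∈ s with b' < b, (1 + c b') := Finset.prod_one_add_ordered s c
  refine SqEq.symm ?_
  refine ((hlin).mul_left (1 + t)).trans ?_
  have hexp : (1 + t) * (1 + t * ∑ b ∈ s, c b * ∏ b' ∈ s with b' < b, (1 + c b')) =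
      (1 + t * ∏ b ∈ s, (1 + c b)) + t * t * ∑ b ∈ s, c b * ∏ b' ∈ s with b' < b, (1 + c b') := by
    rw [htel]; ring
  rw [hexp]
  have h2 := (SqEq.refl (1 + t * ∏ b ∈ s, (1 + c b))).add (ht (∑ b ∈ s, c b * ∏ b' ∈ s with b' < b, (1 + c b')))
  rw [add_zero] at h2
  exact h2

/-! ## 3. Normal forms of the two halves of `Π` -/

/-- `x`-variable and `y`-variable shorthands. -/
abbrev xv (a : Fin h) : MvPolynomial (Fin (h + h)) ℂ := X (Fin.castAdd h a)
/-- `y_d`. -/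
abbrev yv (d : Fin h) : MvPolynomial (Fin (h + h)) ℂ := X (Fin.natAdd h d)

/-- The square-free monomial `x^A y^S` is `monomial (pexpo A S) 1`. -/
theorem prod_xv_mul_prod_yv (A S : Finset (Fin h)) :
    (∏ a ∈ A, xv a) * (∏ d ∈ S, yv d) = monomial (pexpo A S) (1 : ℂ) := by
  rw [BrickCalculus.prod_X_eq_monomial, BrickCalculus.prod_X_eq_monomial, monomial_mul, one_mul, pexpo_def]

/-- Coefficient extraction from a double sum of square-free monomials. -/
theorem coeff_pexpo_sum_monomial (c : Finset (Fin h) → Finset (Fin h) → ℂ) (U W : Finset (Fin h)) :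
    coeff (pexpo U W) (∑ A : Finset (Fin h), ∑ S : Finset (Fin h), monomial (pexpo A S) (c A S)) = c U W := by
  classical
  rw [coeff_sum]
  simp_rw [coeff_sum, coeff_monomial]
  have hinner : ∀ A : Finset (Fin h), (∑ S : Finset (Fin h), if pexpo A S = pexpo U W then c A S else 0) =
      if A = U then c A W else 0 := by
    intro A
    by_cases hA : A = U
    · subst hA
      rw [if_pos rfl, Finset.sum_eq_single W]
      · simp
      · intro S _ hS
        rw [if_neg]; intro hc; exact hS (DistinctAnchors.pexpo_inj hc).2
      · intro hW; exact absurd (Finset.mem_univ W) hW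
    · rw [if_neg hA]
      refine Finset.sum_eq_zero fun S _ => ?_
      rw [if_neg]; intro hc; exact hA (DistinctAnchors.pexpo_inj hc).1
  simp_rw [hinner]
  rw [Finset.sum_ite_eq' Finset.univ U]; simp

/-- **Normal form of the `x`-half:** `∏_d (1 + y_d ∏_b (1 + g_{bd} x_b)) ≡ Σ_{A,S} (∏_{b∈A} Σ_{d∈S} g_{bd}) x^A y^S`. -/
theorem nf_xhalf (g : Fin h → Fin h → ℂ) :
    SqEq (∏ d : Fin h, (1 + yv d * ∏ b : Fin h, (1 + C (g b d) * xv b)))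
      (∑ A : Finset (Fin h), ∑ S : Finset (Fin h), monomial (pexpo A S) (∏ b ∈ A, ∑ d ∈ S, g b d)) := by
  classical
  -- for each S: ∏_{d∈S} y_d ε_d = y^S · ∏_b ∏_{d∈S} (1 + g x_b) ≡ y^S · ∏_b (1 + x_b Σ_{d∈S} g) = Σ_A (...) x^A y^S
  have hS : ∀ S : Finset (Fin h), SqEq (∏ d ∈ S, (yv d * ∏ b : Fin h, (1 + C (g b d) * xv b)))
      (∑ A : Finset (Fin h), monomial (pexpo A S) (∏ b ∈ A, ∑ d ∈ S, g b d)) := by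
    intro S
    rw [Finset.prod_mul_distrib, Finset.prod_comm]
    have hb : ∀ b : Fin h, SqEq (∏ d ∈ S, (1 + C (g b d) * xv b)) (1 + xv b * ∑ d ∈ S, C (g b d)) := by
      intro b
      have := prod_one_add_nil S (xv b) (fun d => C (g b d)) (fun H => SqEq.sq_mul_zero _ H)
      refine (SqEq.prod S fun d _ => ?_).trans this
      rw [mul_comm]; exact SqEq.refl _
    have hprod := SqEq.prod (Finset.univ : Finset (Fin h)) (fun b _ => hb b)
    refine (hprod.mul_left _).trans ?_
    rw [Finset.prod_one_add, Finset.powerset_univ, Finset.mul_sum]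
    have hC : ∀ A : Finset (Fin h), C (∏ b ∈ A, ∑ d ∈ S, g b d) = ∏ b ∈ A, ∑ d ∈ S, (C (g b d) : MvPolynomial (Fin (h + h)) ℂ) := by
      intro A
      rw [map_prod]
      exact Finset.prod_congr rfl fun b _ => map_sum C _ _
    have hterm : ∀ A ∈ (Finset.univ : Finset (Finset (Fin h))),
        (∏ d ∈ S, yv d) * ∏ b ∈ A, (xv b * ∑ d ∈ S, C (g b d)) = monomial (pexpo A S) (∏ b ∈ A, ∑ d ∈ S, g b d) := by
      intro A _
      rw [Finset.prod_mul_distrib, ← hC A,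
        show (∏ d ∈ S, yv d) * ((∏ b ∈ A, xv b) * C (∏ b ∈ A, ∑ d ∈ S, g b d)) =
            C (∏ b ∈ A, ∑ d ∈ S, g b d) * ((∏ b ∈ A, xv b) * ∏ d ∈ S, yv d) by ring,
        prod_xv_mul_prod_yv, C_mul_monomial, mul_one]
    rw [Finset.sum_congr rfl hterm]
    exact SqEq.refl _
  have key : SqEq (∏ d : Fin h, (1 + yv d * ∏ b : Fin h, (1 + C (g b d) * xv b)))
      (∑ S : Finset (Fin h), ∑ A : Finset (Fin h), monomial (pexpo A S) (∏ b ∈ A, ∑ d ∈ S, g b d)) := by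
    rw [Finset.prod_one_add, Finset.powerset_univ]
    exact SqEq.sum _ (fun S _ => hS S)
  rw [Finset.sum_comm]
  exact key

/-- **Normal form of the `y`-half:** `∏_a (1 + x_a ∏_e (1 + d_{ae} y_e)) ≡ Σ_{A,S} (∏_{e∈S} Σ_{a∈A} d_{ae}) x^A y^S`. -/
theorem nf_yhalf (dd : Fin h → Fin h → ℂ) :
    SqEq (∏ a : Fin h, (1 + xv a * ∏ e : Fin h, (1 + C (dd a e) * yv e)))
      (∑ A : Finset (Fin h), ∑ S : Finset (Fin h), monomial (pexpo A S) (∏ e ∈ S, ∑ a ∈ A, dd a e)) := by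
  classical
  have hA : ∀ A : Finset (Fin h), SqEq (∏ a ∈ A, (xv a * ∏ e : Fin h, (1 + C (dd a e) * yv e)))
      (∑ S : Finset (Fin h), monomial (pexpo A S) (∏ e ∈ S, ∑ a ∈ A, dd a e)) := by
    intro A
    rw [Finset.prod_mul_distrib, Finset.prod_comm]
    have he : ∀ e : Fin h, SqEq (∏ a ∈ A, (1 + C (dd a e) * yv e)) (1 + yv e * ∑ a ∈ A, C (dd a e)) := by
      intro e
      have := prod_one_add_nil A (yv e) (fun a => C (dd a e)) (fun H => SqEq.sq_mul_zero _ H)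
      refine (SqEq.prod A fun a _ => ?_).trans this
      rw [mul_comm]; exact SqEq.refl _
    have hprod := SqEq.prod (Finset.univ : Finset (Fin h)) (fun e _ => he e)
    refine (hprod.mul_left _).trans ?_
    rw [Finset.prod_one_add, Finset.powerset_univ, Finset.mul_sum]
    have hC : ∀ S : Finset (Fin h), C (∏ e ∈ S, ∑ a ∈ A, dd a e) = ∏ e ∈ S, ∑ a ∈ A, (C (dd a e) : MvPolynomial (Fin (h + h)) ℂ) := by
      intro S
      rw [map_prod]
      exact Finset.prod_congr rfl fun e _ => map_sum C _ _
    have hterm : ∀ S ∈ (Finset.univ : Finset (Finset (Fin h))),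
        (∏ a ∈ A, xv a) * ∏ e ∈ S, (yv e * ∑ a ∈ A, C (dd a e)) = monomial (pexpo A S) (∏ e ∈ S, ∑ a ∈ A, dd a e) := by
      intro S _
      rw [Finset.prod_mul_distrib, ← hC S,
        show (∏ a ∈ A, xv a) * ((∏ e ∈ S, yv e) * C (∏ e ∈ S, ∑ a ∈ A, dd a e)) =
            C (∏ e ∈ S, ∑ a ∈ A, dd a e) * ((∏ a ∈ A, xv a) * ∏ e ∈ S, yv e) by ring,
        prod_xv_mul_prod_yv, C_mul_monomial, mul_one]
    rw [Finset.sum_congr rfl hterm]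
    exact SqEq.refl _
  rw [Finset.prod_one_add, Finset.powerset_univ]
  exact SqEq.sum _ (fun A _ => hA A)

/-! ## 4. Coefficients of products with square-free monomials; the star entry -/

/-- `coeff_{x^U y^W} (F · c x^{A'} y^{S'}) = [A' ⊆ U][S' ⊆ W] · c · coeff_{x^{U∖A'} y^{W∖S'}} F`. -/
theorem coeff_pexpo_mul_monomial (F : MvPolynomial (Fin (h + h)) ℂ) (c : ℂ) (U W A' S' : Finset (Fin h)) :
    coeff (pexpo U W) (F * monomial (pexpo A' S') c) =
      if A' ⊆ U ∧ S' ⊆ W then coeff (pexpo (U \ A') (W \ S')) F * c else 0 := by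
  classical
  rw [coeff_mul_monomial']
  by_cases hsub : A' ⊆ U ∧ S' ⊆ W
  · rw [if_pos ((pexpo_le_iff A' S' U W).mpr hsub), if_pos hsub, pexpo_sub A' S' U W hsub.1 hsub.2]
  · rw [if_neg (fun hle => hsub ((pexpo_le_iff A' S' U W).mp hle)), if_neg hsub]

/-- Coefficients of `F · (Σ_{A,S} c_{A,S} x^A y^S)`: a sum over the sub-pairs of `(U, W)`. -/
theorem coeff_pexpo_mul_sum_monomial (F : MvPolynomial (Fin (h + h)) ℂ) (c : Finset (Fin h) → Finset (Fin h) → ℂ)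
    (U W : Finset (Fin h)) :
    coeff (pexpo U W) (F * ∑ A : Finset (Fin h), ∑ S : Finset (Fin h), monomial (pexpo A S) (c A S)) =
      ∑ A ∈ U.powerset, ∑ S ∈ W.powerset, coeff (pexpo (U \ A) (W \ S)) F * c A S := by
  classical
  rw [Finset.mul_sum, coeff_sum]
  simp_rw [Finset.mul_sum, coeff_sum, coeff_pexpo_mul_monomial]
  -- restrict the sums to the subsets of U and W
  rw [← Finset.sum_filter_add_sum_filter_not Finset.univ (fun A => A ⊆ U)]
  have hzero : ∑ A ∈ Finset.univ.filter (fun A : Finset (Fin h) => ¬ A ⊆ U), ∑ S : Finset (Fin h),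
      (if A ⊆ U ∧ S ⊆ W then coeff (pexpo (U \ A) (W \ S)) F * c A S else 0) = 0 := by
    refine Finset.sum_eq_zero fun A hA => Finset.sum_eq_zero fun S _ => ?_
    rw [Finset.mem_filter] at hA
    rw [if_neg (fun hh => hA.2 hh.1)]
  rw [hzero, add_zero]
  have hU : Finset.univ.filter (fun A : Finset (Fin h) => A ⊆ U) = U.powerset := by
    ext A; simp
  rw [hU]
  refine Finset.sum_congr rfl fun A hA => ?_
  have hAU : A ⊆ U := Finset.mem_powerset.mp hA
  rw [← Finset.sum_filter_add_sum_filter_not Finset.univ (fun S => S ⊆ W)]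
  have hzero' : ∑ S ∈ Finset.univ.filter (fun S : Finset (Fin h) => ¬ S ⊆ W),
      (if A ⊆ U ∧ S ⊆ W then coeff (pexpo (U \ A) (W \ S)) F * c A S else 0) = 0 := by
    refine Finset.sum_eq_zero fun S hS => ?_
    rw [Finset.mem_filter] at hS
    rw [if_neg (fun hh => hS.2 hh.2)]
  rw [hzero', add_zero]
  have hW : Finset.univ.filter (fun S : Finset (Fin h) => S ⊆ W) = W.powerset := by
    ext S; simp
  rw [hW]
  refine Finset.sum_congr rfl fun S hS => ?_
  rw [if_pos ⟨hAU, Finset.mem_powerset.mp hS⟩]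

/-- The product polynomial `Π(g, d) = ∏_d (1 + y_d ∏_b (1 + g_{bd} x_b)) · ∏_a (1 + x_a ∏_e (1 + d_{ae} y_e))`. -/
def piPoly (g dd : Fin h → Fin h → ℂ) : MvPolynomial (Fin (h + h)) ℂ :=
  (∏ d : Fin h, (1 + yv d * ∏ b : Fin h, (1 + C (g b d) * xv b))) *
    (∏ a : Fin h, (1 + xv a * ∏ e : Fin h, (1 + C (dd a e) * yv e)))

/-- **`coeff_{x^U y^W} Π(g,d) = starEntry g d U W`** — the layout of the (zeta-twisted) product door is the star-forest matrix. -/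
theorem coeff_pexpo_piPoly (g dd : Fin h → Fin h → ℂ) (U W : Finset (Fin h)) :
    coeff (pexpo U W) (piPoly g dd) = starEntry g dd U W := by
  classical
  have hsq := (nf_xhalf g).mul (nf_yhalf dd)
  rw [piPoly, hsq (pexpo U W) (pexpo_apply_le_one U W), coeff_pexpo_mul_sum_monomial]
  -- the x-half coefficient at (U∖A, W∖S)
  simp_rw [coeff_pexpo_sum_monomial]
  -- reindex S ↦ W \ S and match `starEntry`
  rw [starEntry]
  refine Finset.sum_congr rfl fun A hA => ?_
  refine Finset.sum_nbij' (fun S => W \ S) (fun S => W \ S) ?_ ?_ ?_ ?_ ?_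
  · intro S hS; exact Finset.mem_powerset.mpr Finset.sdiff_subset
  · intro S hS; exact Finset.mem_powerset.mpr Finset.sdiff_subset
  · intro S hS; exact Finset.sdiff_sdiff_eq_self (Finset.mem_powerset.mp hS)
  · intro S hS; exact Finset.sdiff_sdiff_eq_self (Finset.mem_powerset.mp hS)
  · intro S hS
    rw [Finset.sdiff_sdiff_eq_self (Finset.mem_powerset.mp hS)]

end StarDoor

end

end Summit.ValiantsHypothesis.ValiantsHypothesis.Theorems.BarrierLever.AnchoredPeeling
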